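import Summits.ValiantsHypothesis.ValiantsHypothesis.Theorems.LacunarySymmetroidMatrixDescartesPivotRankOneCriticalWindowsParallelTwoLaw

/-!
# `MatrixDescartes` census — rank-one `(2,K)₁`: THE PARALLEL TWO-LETTER PER-SIDE LAW ON THE LEFT SIDE (by inversion)

HONEST FRAMING.  Object-search cell `pub-symmetroid`, seat `val-sym-mdr-p1` (generation 25); helper file `--supports` the crux item
stmt-ValiantsHypothesis-18050 (`Theses.LacunarySymmetroid.MatrixDescartes`, OPEN, on HOLD) with NO closure claim.  The mirror image of
`…ParallelTwoLaw.parallel_two_law`, exactly as `…LoneLetterLeft` mirrors `…LoneLetter` in generation 24: the INVERSION `T ↦ 1/T`,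
`C ↦ 1/C`, `wₚ ↦ wₚC²` maps the two critical equations of the pencil «pivot letter at position `C`, two parallel letters at position `1`»
to themselves up to the factors `∓1/T²` (`critical_pair_inversion`), keeps the scales `x`, and exchanges the two sides of the pivot
letter.  Hence **`parallel_two_law_left`**: pivot letter at `C > 1`, two PARALLEL letters at `1` below it (any positive weights, exponents
`dₚ + γᵢ`, rates `a > 0`, `0 < b₁ < b₂`, `γᵢ = a + bᵢ`) ⇒ NO four critical points `(xᵢ, Tᵢ)` with `0 < Tᵢ < C` and `x₁ < x₂ < x₃ < x₄` —
at most three critical directions on the letters' side, now on both sides.  A COUNT of critical directions for one cell of one rank-one row;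
nothing here bears on `MatrixDescartes` in its window, on `DoorA26` / `DoorA34`, registers / ζ, or `VP ≠ VNP`.

[folklore] Change of variables (`field_simp`, `ring`); the tree theorem named above.  No definitions, no named facts.
-/

-- `Summit.ValiantsHypothesis.ValiantsHypothesis.…` repeats a component by the D-0017 layout
-- (single-conjunct summit), which the `dupNamespace` linter flags; the name is mandated.
set_option linter.dupNamespace false

namespace Summit.ValiantsHypothesis.ValiantsHypothesis.Theorems.LacunarySymmetroidMatrixDescartes.Pivot.CriticalWindows.ParallelTwo

/-- **INVERSION OF ONE PAIR OF CRITICAL EQUATIONS (pivot + two parallel letters).**  With `T' = 1/T`, `c = 1/C` and the pivot weight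
rescaled to `wₚC²`, the two critical equations at `(x, T)` for the pivot letter at position `C` and the parallel letters at position `1` become
the two critical equations at `(x, 1/T)` for the pivot letter at position `1/C` (factors `−1/T²`, `1/T²`). [folklore] -/
theorem critical_pair_inversion {wp wj wk C a b₁ b₂ x T : ℝ} {dp γ₁ γ₂ : ℕ} (hC : C ≠ 0) (hT : T ≠ 0)
    (l : wp * x ^ dp * (T ^ 2 - C ^ 2) + (wj * x ^ (dp + γ₁) + wk * x ^ (dp + γ₂)) * (T ^ 2 - 1 ^ 2) = 0)
    (l' : -a * (wp * x ^ dp) * (T - C) ^ 2 + (b₁ * (wj * x ^ (dp + γ₁)) + b₂ * (wk * x ^ (dp + γ₂))) * (T - 1) ^ 2 = 0) :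
    (wp * C ^ 2) * x ^ dp * ((1 / T) ^ 2 - (1 / C) ^ 2)
        + (wj * x ^ (dp + γ₁) + wk * x ^ (dp + γ₂)) * ((1 / T) ^ 2 - 1 ^ 2) = 0 ∧
    -a * ((wp * C ^ 2) * x ^ dp) * ((1 / T) - (1 / C)) ^ 2
        + (b₁ * (wj * x ^ (dp + γ₁)) + b₂ * (wk * x ^ (dp + γ₂))) * ((1 / T) - 1) ^ 2 = 0 := by
  constructor
  · have e : (wp * C ^ 2) * x ^ dp * ((1 / T) ^ 2 - (1 / C) ^ 2)
        + (wj * x ^ (dp + γ₁) + wk * x ^ (dp + γ₂)) * ((1 / T) ^ 2 - 1 ^ 2)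
        = -(1 / T ^ 2) * (wp * x ^ dp * (T ^ 2 - C ^ 2) + (wj * x ^ (dp + γ₁) + wk * x ^ (dp + γ₂)) * (T ^ 2 - 1 ^ 2)) := by
      field_simp
      ring
    rw [e, l, mul_zero]
  · have e : -a * ((wp * C ^ 2) * x ^ dp) * ((1 / T) - (1 / C)) ^ 2
        + (b₁ * (wj * x ^ (dp + γ₁)) + b₂ * (wk * x ^ (dp + γ₂))) * ((1 / T) - 1) ^ 2
        = (1 / T ^ 2) * (-a * (wp * x ^ dp) * (T - C) ^ 2
            + (b₁ * (wj * x ^ (dp + γ₁)) + b₂ * (wk * x ^ (dp + γ₂))) * (T - 1) ^ 2) := by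
      field_simp
      ring
    rw [e, l', mul_zero]

/-- **THE PARALLEL TWO-LETTER PER-SIDE LAW, LEFT SIDE (by inversion).**  Pivot letter at position `C > 1` (weight `wₚ > 0`, exponent `dₚ`),
two parallel letters at position `1` BELOW it (weights `w_j, w_k > 0`, exponents `dₚ + γ₁`, `dₚ + γ₂`), rates `a > 0`, `0 < b₁ < b₂` with
`γᵢ = a + bᵢ`: the window profile has NO FOUR critical points `(xᵢ, Tᵢ)` with `0 < Tᵢ < C` and scales `x₁ < x₂ < x₃ < x₄` — at most three
critical directions below the pivot letter.  Proof: the inversion `T ↦ 1/T`, `C ↦ 1/C`, `wₚ ↦ wₚC²` (`critical_pair_inversion`) keeps the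
scales and maps the data to the hypotheses of `parallel_two_law`. [this file] -/
theorem parallel_two_law_left {wp wj wk C a b₁ b₂ : ℝ} {dp γ₁ γ₂ : ℕ} (hwp : 0 < wp) (hwj : 0 < wj) (hwk : 0 < wk)
    (hC : 1 < C) (ha : 0 < a) (hb₁ : 0 < b₁) (hb₁₂ : b₁ < b₂) (hγ₁ : (γ₁ : ℝ) = a + b₁) (hγ₂ : (γ₂ : ℝ) = a + b₂)
    {x₁ x₂ x₃ x₄ T₁ T₂ T₃ T₄ : ℝ} (hx₁ : 0 < x₁) (h₁₂ : x₁ < x₂) (h₂₃ : x₂ < x₃) (h₃₄ : x₃ < x₄)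
    (hT₁ : 0 < T₁) (hT₂ : 0 < T₂) (hT₃ : 0 < T₃) (hT₄ : 0 < T₄)
    (hT₁C : T₁ < C) (hT₂C : T₂ < C) (hT₃C : T₃ < C) (hT₄C : T₄ < C)
    (l₁ : wp * x₁ ^ dp * (T₁ ^ 2 - C ^ 2) + (wj * x₁ ^ (dp + γ₁) + wk * x₁ ^ (dp + γ₂)) * (T₁ ^ 2 - 1 ^ 2) = 0)
    (l₁' : -a * (wp * x₁ ^ dp) * (T₁ - C) ^ 2 + (b₁ * (wj * x₁ ^ (dp + γ₁)) + b₂ * (wk * x₁ ^ (dp + γ₂))) * (T₁ - 1) ^ 2 = 0)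
    (l₂ : wp * x₂ ^ dp * (T₂ ^ 2 - C ^ 2) + (wj * x₂ ^ (dp + γ₁) + wk * x₂ ^ (dp + γ₂)) * (T₂ ^ 2 - 1 ^ 2) = 0)
    (l₂' : -a * (wp * x₂ ^ dp) * (T₂ - C) ^ 2 + (b₁ * (wj * x₂ ^ (dp + γ₁)) + b₂ * (wk * x₂ ^ (dp + γ₂))) * (T₂ - 1) ^ 2 = 0)
    (l₃ : wp * x₃ ^ dp * (T₃ ^ 2 - C ^ 2) + (wj * x₃ ^ (dp + γ₁) + wk * x₃ ^ (dp + γ₂)) * (T₃ ^ 2 - 1 ^ 2) = 0)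
    (l₃' : -a * (wp * x₃ ^ dp) * (T₃ - C) ^ 2 + (b₁ * (wj * x₃ ^ (dp + γ₁)) + b₂ * (wk * x₃ ^ (dp + γ₂))) * (T₃ - 1) ^ 2 = 0)
    (l₄ : wp * x₄ ^ dp * (T₄ ^ 2 - C ^ 2) + (wj * x₄ ^ (dp + γ₁) + wk * x₄ ^ (dp + γ₂)) * (T₄ ^ 2 - 1 ^ 2) = 0)
    (l₄' : -a * (wp * x₄ ^ dp) * (T₄ - C) ^ 2 + (b₁ * (wj * x₄ ^ (dp + γ₁)) + b₂ * (wk * x₄ ^ (dp + γ₂))) * (T₄ - 1) ^ 2 = 0) :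
    False := by
  have hC0 : 0 < C := one_pos.trans hC
  have hc : 0 < 1 / C := by positivity
  have hc1 : 1 / C < 1 := (div_lt_one hC0).2 hC
  have hwp' : 0 < wp * C ^ 2 := by positivity
  have inv : ∀ {T : ℝ}, 0 < T → T < C → 1 / C < 1 / T := fun hT hTC => one_div_lt_one_div_of_lt hT hTC
  obtain ⟨c₁, c₁'⟩ := critical_pair_inversion hC0.ne' hT₁.ne' l₁ l₁'
  obtain ⟨c₂, c₂'⟩ := critical_pair_inversion hC0.ne' hT₂.ne' l₂ l₂'
  obtain ⟨c₃, c₃'⟩ := critical_pair_inversion hC0.ne' hT₃.ne' l₃ l₃'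
  obtain ⟨c₄, c₄'⟩ := critical_pair_inversion hC0.ne' hT₄.ne' l₄ l₄'
  exact parallel_two_law hwp' hwj hwk hc hc1 ha hb₁ hb₁₂ hγ₁ hγ₂ hx₁ h₁₂ h₂₃ h₃₄ (inv hT₁ hT₁C) (inv hT₂ hT₂C) (inv hT₃ hT₃C)
    (inv hT₄ hT₄C) c₁ c₁' c₂ c₂' c₃ c₃' c₄ c₄'

end Summit.ValiantsHypothesis.ValiantsHypothesis.Theorems.LacunarySymmetroidMatrixDescartes.Pivot.CriticalWindows.ParallelTwo
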